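import Literature.NumberTheory.EllipticCurves.SubgroupSelmerCocycleCriteriaProofs
import HarnessLib

/-!
# Route `SignedLowerHalves`, crux L `SmallImageLowerHalfBothSigns` (stmt-BirchSwinnertonDyer-23599), line `rtt_w3` v14 — E2, row (5′) `Col`,
# part (B): `H¹` OF A SPLIT COEFFICIENT MODULE — a `G`-equivariant splitting `M ≅ N^d` of discrete `G`-modules induces, for every subgroup
# `H ≤ G`, an additive isomorphism `H¹(H, M) ≃+ (Fin d → H¹(H, N))` commuting with restriction and conjugation

WIDTH seat `bsd-line-slh-p3-w3` g21 under LEAD `cruxlead-stmt-BirchSwinnertonDyer-23599` g11 (cell `bsd-ssimc`); helper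
`--supports stmt-BirchSwinnertonDyer-23599`. THEOREMS + two generic auxiliary definitions (`coeffH1`, `splitH1Equiv`); no named fact, no instance,
no `sorry`. Nothing about E2 / crux L / BSD is asserted or proved here.

WHY (row (5′) of BRIEF-E2 rev 4 §3 / HELPER-TABLE v14 section: `Col : DQ.X ≃ₗ[Λ_𝒪] Λ_𝒪`). By -w3 g20's free descent
`SmallImageRttD2Seq.nonempty_linearEquiv_iwasawaAlgebraO_of_finrank_eq` (p781527) the Coleman carrier `Col` exists as soon as the local dual
`DQ.X = (E^{ε}_{sat,v})^∨` is `Λ`-free of rank `[F_S : ℚ_p]`. The route (bus 2026-08-30T18:02Z): the local coefficient module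
`M = (F_S/𝒪_S)(θ)|_{Γ_{K_v}}` SPLITS `Γ_{K_v}`-equivariantly as `W_K[p^∞]^d` (`2d = [F_S : ℚ_p]`, honda's coordinates
`…RttCharRoadCoordinates`), so `H¹(U, M) ≅ H¹(U, W_K[p^∞])^d` for every local group `U`, the saturated condition `E^{ε}_{sat,v}` corresponding
to `(ℋ^ε)^d` (parts (C)/(D)); dually `DQ.X ≅ XLoc^d` and Kim–Park Prop. 2.12/3.3 (`XLoc` free of rank `2`, fact p773229) gives the rank.
THIS FILE is the generic cohomological step (B), for an arbitrary topological group `G`, subgroup `H ≤ G` and discrete `G`-modules `M`, `N`: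

* §1 `coeffH1 H ψ hψ : H¹(H, M) →+ H¹(H, N)` — functoriality of `H¹(H, –)` in a `G`-equivariant additive map `ψ : M → N` (the compatible pair
  `(id_H, ψ)`, `resH1Hom`); on cocycles `[φ] ↦ [ψ ∘ φ]` (`coeffH1_oneCocycleClass`); `coeffH1` is additive and functorial in `ψ`
  (`coeffH1_add/_zero/_sum/_id/_comp`) and commutes with restriction `resOfLe` and conjugation `conjH1`.
* §2 for a SPLITTING (`π i : M →+ N`, `e i : N →+ M`, `G`-equivariant, `Σ_i e_i ∘ π_i = id`, `π_i ∘ e_k = δ_{ik}`):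
  ★ `splitH1Equiv : H¹(H, M) ≃+ (Fin d → H¹(H, N))`, `c ↦ (coeffH1 (π i) c)_i`, inverse `(c_i) ↦ Σ_i coeffH1 (e i) c_i`, with
  `splitH1Equiv_resOfLe` / `splitH1Equiv_conjH1` (componentwise).
References: [SerreGaloisCohomology1997] I.§2.2–§2.5 (functoriality of cohomology in compatible pairs; additivity); [NeukirchSchmidtWingberg2008] I.§3, I.§5.
-/

set_option autoImplicit false
set_option linter.dupNamespace false -- D-0017: single-problem summit, the namespace repeats the problem name by design
noncomputable section

open scoped Classical

universe u

namespace Summit.BirchSwinnertonDyer.BirchSwinnertonDyer.Theorems.SmallImageRttD2Seq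

open Literature.NumberTheory.EllipticCurves Literature.NumberTheory.GaloisRepresentations

/-! ## §1. Functoriality of `H¹(H, –)` in an equivariant map of coefficients -/

section Coeff

variable {G : Type u} [Group G] [TopologicalSpace G] [IsTopologicalGroup G] (H : Subgroup G)
  {M : Type u} [AddCommGroup M] [DistribMulAction G M] [TopologicalSpace M] [DiscreteTopology M]
  {N : Type u} [AddCommGroup N] [DistribMulAction G N] [TopologicalSpace N] [DiscreteTopology N]
  {P : Type u} [AddCommGroup P] [DistribMulAction G P] [TopologicalSpace P] [DiscreteTopology P]

/-- **`ψ_* : H¹(H, M) → H¹(H, N)`** for a `G`-equivariant additive `ψ : M → N`: functoriality of continuous cohomology along the compatible pair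
`(id_H, ψ)` (`resH1Hom`). [cite: SerreGaloisCohomology1997, I.§2.4] -/
def coeffH1 (ψ : M →+ N) (hψ : ∀ (g : G) (m : M), ψ (g • m) = g • ψ m) : subgroupH1 H M →+ subgroupH1 H N :=
  resH1Hom (ContinuousMonoidHom.id H) ψ fun x m ↦ hψ (x : G) m

/-- On explicit cocycle classes `ψ_* [φ] = [ψ ∘ φ]` (`map_oneCocycleClass`). [cite: SerreGaloisCohomology1997, I.§2.4] -/
theorem coeffH1_oneCocycleClass (ψ : M →+ N) (hψ : ∀ (g : G) (m : M), ψ (g • m) = g • ψ m)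
    (φ : contOneCocycles (discreteTopRep H M)) :
    coeffH1 H ψ hψ (oneCocycleClass _ φ) =
      oneCocycleClass _ (contOneCocycles.pullback (ContinuousMonoidHom.id H)
        (resHomOfEquivariant (ContinuousMonoidHom.id H) ψ fun x m ↦ hψ (x : G) m) φ) :=
  map_oneCocycleClass _ _ _ φ

omit [IsTopologicalGroup G] in
/-- The pulled-back cocycle is `ψ ∘ φ` as a function on `H`. [cite: SerreGaloisCohomology1997, I.§2.4] -/
theorem coe_pullback_id_eq_comp (ψ : M →+ N) (hψ : ∀ (g : G) (m : M), ψ (g • m) = g • ψ m)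
    (φ : contOneCocycles (discreteTopRep H M)) :
    (⇑(contOneCocycles.pullback (ContinuousMonoidHom.id H)
        (resHomOfEquivariant (ContinuousMonoidHom.id H) ψ fun x m ↦ hψ (x : G) m) φ).1 : H → N) = fun τ ↦ ψ (φ.1 τ) := by
  funext τ
  rw [contOneCocycles.pullback_apply]
  rfl

/-- **Every class of `H¹(H, M)` is mapped by `ψ_*` to the class of `ψ ∘ φ` for any representing cocycle `φ`** (existential form of
`coeffH1_oneCocycleClass`, convenient for membership arguments on cocycles). [cite: SerreGaloisCohomology1997, I.§2.4] -/
theorem exists_coeffH1_oneCocycleClass (ψ : M →+ N) (hψ : ∀ (g : G) (m : M), ψ (g • m) = g • ψ m)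
    (φ : contOneCocycles (discreteTopRep H M)) :
    ∃ φ' : contOneCocycles (discreteTopRep H N), oneCocycleClass _ φ' = coeffH1 H ψ hψ (oneCocycleClass _ φ) ∧
      (⇑φ'.1 : H → N) = fun τ ↦ ψ (φ.1 τ) :=
  ⟨_, (coeffH1_oneCocycleClass H ψ hψ φ).symm, coe_pullback_id_eq_comp H ψ hψ φ⟩

/-- `(id_M)_* = id`. [cite: SerreGaloisCohomology1997, I.§2.4] -/
theorem coeffH1_id : coeffH1 H (AddMonoidHom.id M) (fun _ _ ↦ rfl) = AddMonoidHom.id (subgroupH1 H M) :=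
  resH1Hom_id

/-- `coeffH1` only depends on `ψ` (proof-irrelevant congruence). [cite: SerreGaloisCohomology1997, I.§2.4] -/
theorem coeffH1_congr {ψ ψ' : M →+ N} (h : ψ = ψ') (hψ : ∀ (g : G) (m : M), ψ (g • m) = g • ψ m)
    (hψ' : ∀ (g : G) (m : M), ψ' (g • m) = g • ψ' m) : coeffH1 H ψ hψ = coeffH1 H ψ' hψ' := by
  subst h; rfl

/-- Functoriality: `(ψ' ∘ ψ)_* = ψ'_* ∘ ψ_*`. [cite: SerreGaloisCohomology1997, I.§2.4] -/
theorem coeffH1_comp (ψ : M →+ N) (hψ : ∀ (g : G) (m : M), ψ (g • m) = g • ψ m)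
    (ψ' : N →+ P) (hψ' : ∀ (g : G) (n : N), ψ' (g • n) = g • ψ' n) :
    (coeffH1 H ψ' hψ').comp (coeffH1 H ψ hψ) =
      coeffH1 H (ψ'.comp ψ) (fun g m ↦ by rw [AddMonoidHom.comp_apply, AddMonoidHom.comp_apply, hψ, hψ']) := by
  rw [coeffH1, coeffH1, resH1Hom_comp]
  rfl

/-- **Additivity in the coefficient map**: `(ψ + ψ')_* = ψ_* + ψ'_*` (on cocycles `(ψ + ψ') ∘ φ = ψ ∘ φ + ψ' ∘ φ`).
[cite: SerreGaloisCohomology1997, I.§2.2] -/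
theorem coeffH1_add (ψ ψ' : M →+ N) (hψ : ∀ (g : G) (m : M), ψ (g • m) = g • ψ m)
    (hψ' : ∀ (g : G) (m : M), ψ' (g • m) = g • ψ' m) :
    coeffH1 H (ψ + ψ') (fun g m ↦ by rw [AddMonoidHom.add_apply, AddMonoidHom.add_apply, hψ, hψ', smul_add]) =
      coeffH1 H ψ hψ + coeffH1 H ψ' hψ' := by
  ext c
  obtain ⟨φ, rfl⟩ := oneCocycleClass_surjective _ c
  rw [AddMonoidHom.add_apply, coeffH1_oneCocycleClass, coeffH1_oneCocycleClass, coeffH1_oneCocycleClass, ← oneCocycleClass_add]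
  rfl

/-- The zero map of coefficients induces zero. [cite: SerreGaloisCohomology1997, I.§2.2] -/
theorem coeffH1_zero : coeffH1 H (0 : M →+ N) (fun _ _ ↦ by rw [AddMonoidHom.zero_apply, AddMonoidHom.zero_apply, smul_zero]) = 0 := by
  ext c
  obtain ⟨φ, rfl⟩ := oneCocycleClass_surjective _ c
  rw [AddMonoidHom.zero_apply, coeffH1_oneCocycleClass, ← oneCocycleClass_zero]
  rfl

/-- **Additivity over a finite sum of coefficient maps**: `(Σ_i ψ_i)_* = Σ_i (ψ_i)_*`. [cite: SerreGaloisCohomology1997, I.§2.2] -/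
theorem coeffH1_finset_sum {ι : Type*} (s : Finset ι) (ψ : ι → (M →+ N)) (hψ : ∀ (i : ι) (g : G) (m : M), ψ i (g • m) = g • ψ i m)
    (hsum : ∀ (g : G) (m : M), (∑ i ∈ s, ψ i) (g • m) = g • (∑ i ∈ s, ψ i) m) :
    coeffH1 H (∑ i ∈ s, ψ i) hsum = ∑ i ∈ s, coeffH1 H (ψ i) (hψ i) := by
  induction s using Finset.cons_induction with
  | empty =>
    have h0 : (∑ i ∈ (∅ : Finset ι), ψ i) = 0 := Finset.sum_empty
    rw [coeffH1_congr H h0 hsum (fun _ _ ↦ by rw [AddMonoidHom.zero_apply, AddMonoidHom.zero_apply, smul_zero]), coeffH1_zero,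
      Finset.sum_empty]
  | cons a s ha ih =>
    have hs : ∀ (g : G) (m : M), (∑ i ∈ s, ψ i) (g • m) = g • (∑ i ∈ s, ψ i) m := fun g m ↦ by
      rw [AddMonoidHom.finsetSum_apply, AddMonoidHom.finsetSum_apply, Finset.smul_sum]
      exact Finset.sum_congr rfl fun i _ ↦ hψ i g m
    rw [coeffH1_congr H (Finset.sum_cons ha) hsum
      (fun g m ↦ by rw [AddMonoidHom.add_apply, AddMonoidHom.add_apply, hψ, hs, smul_add]), coeffH1_add H (ψ a) _ (hψ a) hs, ih hs,
      Finset.sum_cons]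

/-- **Restriction commutes with `ψ_*`** (both composites are induced by the pair `(H ↪ H', ψ)`; `resH1Hom_comp`).
[cite: NeukirchSchmidtWingberg2008, I.§5] -/
theorem resOfLe_comp_coeffH1 {H H' : Subgroup G} (h : H ≤ H') (ψ : M →+ N) (hψ : ∀ (g : G) (m : M), ψ (g • m) = g • ψ m) :
    (resOfLe N h).comp (coeffH1 H' ψ hψ) = (coeffH1 H ψ hψ).comp (resOfLe M h) := by
  unfold coeffH1 resOfLe
  rw [resH1Hom_comp, resH1Hom_comp]
  exact resH1Hom_congr (by ext; rfl) (by ext; rfl) _ _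

/-- Pointwise form of `resOfLe_comp_coeffH1`. [cite: NeukirchSchmidtWingberg2008, I.§5] -/
theorem resOfLe_coeffH1 {H H' : Subgroup G} (h : H ≤ H') (ψ : M →+ N) (hψ : ∀ (g : G) (m : M), ψ (g • m) = g • ψ m)
    (c : subgroupH1 H' M) : resOfLe N h (coeffH1 H' ψ hψ c) = coeffH1 H ψ hψ (resOfLe M h c) := by
  rw [← AddMonoidHom.comp_apply, resOfLe_comp_coeffH1, AddMonoidHom.comp_apply]

/-- **Conjugation commutes with `ψ_*`** for `G`-equivariant `ψ` (both composites are induced by `(h ↦ σ⁻¹hσ, m ↦ σ • ψ m = ψ (σ • m))`).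
[cite: NeukirchSchmidtWingberg2008, I.§5] -/
theorem conjH1_comp_coeffH1 [H.Normal] (σ : G) (ψ : M →+ N) (hψ : ∀ (g : G) (m : M), ψ (g • m) = g • ψ m) :
    (conjH1 H N σ).comp (coeffH1 H ψ hψ) = (coeffH1 H ψ hψ).comp (conjH1 H M σ) := by
  unfold coeffH1 conjH1
  rw [resH1Hom_comp, resH1Hom_comp]
  exact resH1Hom_congr (by ext; rfl) (by ext m; simp [hψ]) _ _

/-- Pointwise form of `conjH1_comp_coeffH1`. [cite: NeukirchSchmidtWingberg2008, I.§5] -/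
theorem conjH1_coeffH1 [H.Normal] (σ : G) (ψ : M →+ N) (hψ : ∀ (g : G) (m : M), ψ (g • m) = g • ψ m) (c : subgroupH1 H M) :
    conjH1 H N σ (coeffH1 H ψ hψ c) = coeffH1 H ψ hψ (conjH1 H M σ c) := by
  rw [← AddMonoidHom.comp_apply, conjH1_comp_coeffH1, AddMonoidHom.comp_apply]

end Coeff

/-! ## §2. `H¹` of a split module: `H¹(H, M) ≃+ (Fin d → H¹(H, N))` -/

section Split

variable {G : Type u} [Group G] [TopologicalSpace G] [IsTopologicalGroup G] (H : Subgroup G)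
  {M : Type u} [AddCommGroup M] [DistribMulAction G M] [TopologicalSpace M] [DiscreteTopology M]
  {N : Type u} [AddCommGroup N] [DistribMulAction G N] [TopologicalSpace N] [DiscreteTopology N]
  {d : ℕ} (π : Fin d → (M →+ N)) (e : Fin d → (N →+ M))
  (hπ : ∀ (i : Fin d) (g : G) (m : M), π i (g • m) = g • π i m) (he : ∀ (i : Fin d) (g : G) (n : N), e i (g • n) = g • e i n)
  (hsum : ∀ m : M, ∑ i, e i (π i m) = m) (hδ : ∀ (i k : Fin d) (n : N), π i (e k n) = if i = k then n else 0)

/-- The coordinate map `c ↦ ((π_i)_* c)_i : H¹(H, M) → (Fin d → H¹(H, N))`. [cite: SerreGaloisCohomology1997, I.§2.2] -/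
def splitH1 : subgroupH1 H M →+ (Fin d → subgroupH1 H N) :=
  AddMonoidHom.pi fun i ↦ coeffH1 H (π i) (hπ i)

/-- The inverse coordinate map `(c_i)_i ↦ Σ_i (e_i)_* c_i`. [cite: SerreGaloisCohomology1997, I.§2.2] -/
def unsplitH1 : (Fin d → subgroupH1 H N) →+ subgroupH1 H M :=
  ∑ i, (coeffH1 H (e i) (he i)).comp (Pi.evalAddMonoidHom (fun _ : Fin d ↦ subgroupH1 H N) i)

/-- Unfolding `splitH1`. [cite: SerreGaloisCohomology1997, I.§2.2] -/
@[simp]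
theorem splitH1_apply (c : subgroupH1 H M) (i : Fin d) : splitH1 H π hπ c i = coeffH1 H (π i) (hπ i) c :=
  rfl

/-- Unfolding `unsplitH1`. [cite: SerreGaloisCohomology1997, I.§2.2] -/
theorem unsplitH1_apply (c : Fin d → subgroupH1 H N) : unsplitH1 H e he c = ∑ i, coeffH1 H (e i) (he i) (c i) := by
  rw [unsplitH1, AddMonoidHom.finsetSum_apply]
  rfl

include hsum in
/-- `Σ_i (e_i)_* (π_i)_* = id` on `H¹(H, M)` (`Σ_i e_i π_i = id_M` and additivity/functoriality of `(·)_*`). [cite: SerreGaloisCohomology1997, I.§2.2] -/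
theorem unsplitH1_splitH1 (c : subgroupH1 H M) : unsplitH1 H e he (splitH1 H π hπ c) = c := by
  rw [unsplitH1_apply]
  have h1 : ∀ i, coeffH1 H (e i) (he i) (splitH1 H π hπ c i) = coeffH1 H ((e i).comp (π i))
      (fun g m ↦ by rw [AddMonoidHom.comp_apply, AddMonoidHom.comp_apply, hπ, he]) c := fun i ↦ by
    rw [splitH1_apply, ← AddMonoidHom.comp_apply, coeffH1_comp]
  simp_rw [h1]
  have hs : (∑ i, (e i).comp (π i)) = AddMonoidHom.id M := by
    ext m; rw [AddMonoidHom.finsetSum_apply]; exact hsum m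
  rw [← AddMonoidHom.finsetSum_apply, ← coeffH1_finset_sum H Finset.univ (fun i ↦ (e i).comp (π i))
    (fun i g m ↦ by rw [AddMonoidHom.comp_apply, AddMonoidHom.comp_apply, hπ, he]) (fun g m ↦ by rw [hs]; rfl),
    coeffH1_congr H hs _ (fun _ _ ↦ rfl), coeffH1_id, AddMonoidHom.id_apply]

include hδ in
/-- `(π_i)_* (Σ_k (e_k)_* c_k) = c_i` (`π_i e_k = δ_{ik}`). [cite: SerreGaloisCohomology1997, I.§2.2] -/
theorem splitH1_unsplitH1 (c : Fin d → subgroupH1 H N) : splitH1 H π hπ (unsplitH1 H e he c) = c := by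
  funext i
  rw [splitH1_apply, unsplitH1_apply, map_sum]
  have h1 : ∀ k, coeffH1 H (π i) (hπ i) (coeffH1 H (e k) (he k) (c k)) =
      coeffH1 H ((π i).comp (e k)) (fun g n ↦ by rw [AddMonoidHom.comp_apply, AddMonoidHom.comp_apply, he, hπ]) (c k) := fun k ↦ by
    rw [← AddMonoidHom.comp_apply, coeffH1_comp]
  simp_rw [h1]
  rw [Finset.sum_eq_single i]
  · have hii : (π i).comp (e i) = AddMonoidHom.id N := by ext n; rw [AddMonoidHom.comp_apply, hδ, if_pos rfl]; rfl
    rw [coeffH1_congr H hii _ (fun _ _ ↦ rfl), coeffH1_id, AddMonoidHom.id_apply]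
  · intro k _ hki
    have hik : (π i).comp (e k) = 0 := by ext n; rw [AddMonoidHom.comp_apply, hδ, if_neg (Ne.symm hki)]; rfl
    rw [coeffH1_congr H hik _ (fun _ _ ↦ by rw [AddMonoidHom.zero_apply, AddMonoidHom.zero_apply, smul_zero]), coeffH1_zero,
      AddMonoidHom.zero_apply]
  · intro hi; exact absurd (Finset.mem_univ i) hi

/-- ★ **`H¹` of a split module: `H¹(H, M) ≃+ (Fin d → H¹(H, N))`** for a `G`-equivariant splitting `M ≅ N^d` (`π`, `e` with `Σ e_i π_i = id`,
`π_i e_k = δ_{ik}`), `c ↦ ((π_i)_* c)_i` with inverse `(c_i) ↦ Σ (e_i)_* c_i` — additivity of `H¹(H, –)`.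
[cite: SerreGaloisCohomology1997, I.§2.2] [cite: NeukirchSchmidtWingberg2008, I.§3] -/
def splitH1Equiv : subgroupH1 H M ≃+ (Fin d → subgroupH1 H N) :=
  { splitH1 H π hπ with
    invFun := unsplitH1 H e he
    left_inv := unsplitH1_splitH1 H π e hπ he hsum
    right_inv := splitH1_unsplitH1 H π e hπ he hδ }

/-- Unfolding `splitH1Equiv`: the `i`-th coordinate is `(π_i)_*`. [cite: SerreGaloisCohomology1997, I.§2.2] -/
@[simp]
theorem splitH1Equiv_apply (c : subgroupH1 H M) (i : Fin d) : splitH1Equiv H π e hπ he hsum hδ c i = coeffH1 H (π i) (hπ i) c :=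
  rfl

/-- Unfolding the inverse of `splitH1Equiv`: `(c_i) ↦ Σ_i (e_i)_* c_i`. [cite: SerreGaloisCohomology1997, I.§2.2] -/
theorem splitH1Equiv_symm_apply (c : Fin d → subgroupH1 H N) :
    (splitH1Equiv H π e hπ he hsum hδ).symm c = ∑ i, coeffH1 H (e i) (he i) (c i) :=
  unsplitH1_apply H e he c

/-- **The splitting isomorphism commutes with restriction** (componentwise `resOfLe`). [cite: NeukirchSchmidtWingberg2008, I.§5] -/
theorem splitH1Equiv_resOfLe {H H' : Subgroup G} (h : H ≤ H') (c : subgroupH1 H' M) (i : Fin d) :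
    splitH1Equiv H π e hπ he hsum hδ (resOfLe M h c) i = resOfLe N h (splitH1Equiv H' π e hπ he hsum hδ c i) := by
  rw [splitH1Equiv_apply, splitH1Equiv_apply, resOfLe_coeffH1]

/-- **The splitting isomorphism commutes with conjugation** (componentwise `conjH1`). [cite: NeukirchSchmidtWingberg2008, I.§5] -/
theorem splitH1Equiv_conjH1 [H.Normal] (σ : G) (c : subgroupH1 H M) (i : Fin d) :
    splitH1Equiv H π e hπ he hsum hδ (conjH1 H M σ c) i = conjH1 H N σ (splitH1Equiv H π e hπ he hsum hδ c i) := by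
  rw [splitH1Equiv_apply, splitH1Equiv_apply, conjH1_coeffH1]

/-- The inverse splitting isomorphism commutes with conjugation. [cite: NeukirchSchmidtWingberg2008, I.§5] -/
theorem splitH1Equiv_symm_conjH1 [H.Normal] (σ : G) (c : Fin d → subgroupH1 H N) :
    (splitH1Equiv H π e hπ he hsum hδ).symm (fun i ↦ conjH1 H N σ (c i)) = conjH1 H M σ ((splitH1Equiv H π e hπ he hsum hδ).symm c) := by
  apply (splitH1Equiv H π e hπ he hsum hδ).injective
  rw [AddEquiv.apply_symm_apply]
  funext i
  rw [splitH1Equiv_conjH1, AddEquiv.apply_symm_apply]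

/-- The inverse splitting isomorphism commutes with restriction. [cite: NeukirchSchmidtWingberg2008, I.§5] -/
theorem splitH1Equiv_symm_resOfLe {H H' : Subgroup G} (h : H ≤ H') (c : Fin d → subgroupH1 H' N) :
    (splitH1Equiv H π e hπ he hsum hδ).symm (fun i ↦ resOfLe N h (c i)) = resOfLe M h ((splitH1Equiv H' π e hπ he hsum hδ).symm c) := by
  apply (splitH1Equiv H π e hπ he hsum hδ).injective
  rw [AddEquiv.apply_symm_apply]
  funext i
  rw [splitH1Equiv_resOfLe, AddEquiv.apply_symm_apply]

end Split

end Summit.BirchSwinnertonDyer.BirchSwinnertonDyer.Theorems.SmallImageRttD2Seq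

end
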